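import Mathlib
import Literature.MathematicalPhysics.QuantumFieldTheory.Balaban1983to89.B5Ineq167SymbolZd
import Literature.MathematicalPhysics.QuantumFieldTheory.Balaban1983to89.B4Green244

/-!
# Bałaban [B5] (1.66) p.29, scalar, whole lattice `ℤ^d`: the coarse action `⟨B, Δ_kB⟩` and the Dirichlet form
# `⟨∂₁B, ∂₁B⟩` in MOMENTUM REPRESENTATION — `⟨B, Δ_kB⟩ = (2π)^{−d}∫_{[-π,π]^d} σ(p)|B̃(p)|² dp`,
# `⟨∂₁B, ∂₁B⟩ = (2π)^{−d}∫_{[-π,π]^d} ω(p)|B̃(p)|² dp` — and the printed inference MULTIPLIER BOUNDS ⇒ (1.67)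

**Source (verbatim; the quotations LOCATE the statements — nothing printed is used as a hypothesis).**
[B5] = T. Bałaban, *Propagators and renormalization transformations for lattice gauge theories. I*, Commun. Math.
Phys. **95** (1984) 17–40 [`Balaban1984PropagatorsI`].  p. 23 [PDF 7] (render
`b2b-balaban-ref1/pages/1984-cmp95-propagators-rt-I/…-p007-x2.png`, read as an image by the author of this file):
«The momentum representation on an arbitrary torus T′_η = {x ∈ ηℤ^d : −L′_μ ≦ x_μ < L′_μ, μ = 1, …, d} is
introduced by the Fourier transform f̃(p) = Σ_{x∈T′_η} η^d e^{−ip·x} f(x), p ∈ T̃′_η, f(x) = (2π)^{−d} Σ_{p∈T̃′_η}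
(Π_{μ=1}^d π/L′_μ) e^{ix·p} f̃(p), (1.29)» and, same page, «Δ(p) = Σ_{μ=1}^d |∂_μ(p)|², ∂_μ(p) = (e^{iηp_μ} − 1)/η»
[(1.31)].  p. 29 [PDF 13] (render `…-p013-x2.png`): «The action Δ_k is thus defined by ⟨B, Δ_kB⟩ = ⟨∂H_kB, ∂H_kB⟩.
(1.65)  Using formulas (1.60) or (1.63) we obtain the following expression ⟨B, Δ_kB⟩ = ½Σ_{μ,ν}⟨(∂¹_μB_ν − ∂¹_νB_μ),
φ_μ^{−1}φ_ν^{−1}(∂₁*φ^{−1}∂₁)^{−1}(∂¹_μB_ν − ∂¹_νB_μ)⟩ = ⟨∂₁B, σ_k∂₁B⟩ = ½Σ_{μ,ν}(2π)^{−d}∫dp′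
[1 / ((Σ_{λ=1}^d |∂¹_λ(p′)|²/(Δ₀²(p′)φ_λ(p′))) Δ₀(p′)φ_μ(p′)Δ₀(p′)φ_ν(p′))] |(∂₁B)~_{μν}(p′)|². (1.66)  The function
under the integral is bounded from below and above by positive constants γ₀, γ₁ dependent on d only, so we have
γ₀⟨∂₁B, ∂₁B⟩ ≦ ⟨B, Δ_kB⟩ ≦ γ₁⟨∂₁B, ∂₁B⟩. (1.67)».  The print states (1.66) for the VECTOR operator on a torus and
argues MULTIPLIER ⇒ FORM; neither a derivation of (1.66) nor the bounds on the multiplier are printed.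

**What is proved here (zero `sorry`; every `d`, every block side `n + 1 ≥ 1`, every `a > 0`, every finite window
`T ⊂ ℤ^d`).**  Objects: the scalar whole-lattice line of this seat (`B6QGQLower276` … `B5Hk165TranslZd`,
`B5Ineq167UpperZd`) and node g8-2 `B5Ineq167SymbolZd`: the coarse action form `actionForm n a T B =
Σ_{y″,y∈T} B(y″)B(y)Δ^{scalar}(y″,y)` of (1.65) (node 8), its convolution kernel `kappa` and SYMBOL
`sigma n a p = Σ'_z κ(z)cos(p·z)` (node g8-2), the Dirichlet form `energy B = Σ_μ Σ'_y (B(y) − B(y + e_μ))²` with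
symbol `omega p = Σ_μ (2 − 2cos p_μ)`; the Brillouin zone `B4ContourShift.BZ d = [-π,π]^d` and the character
orthogonality `B4Green244.fourierBox_one` of the torus-free Green's-function file.
* §1–§3 [folklore] zone facts (`volume_real_BZ`: `|[-π,π]^d| = (2π)^d`), the real phase `p·z` of node g8-2 versus
  the complex phase of `B4ContourShift` (`phaseC_eq`), **`integral_cos_phase`: `∫cos(p·z)dp = (2π)^d δ_{z0}`**
  (the real part of `fourierBox_one`) and `integral_cos_mul_cos`.
* §4 [(1.29) at `η = 1`] **`FT T B p = Σ_{y∈T} B(y)e^{−ip·y}`** on a window `T`, `FTsq` = `|B̃(p)|²` as the real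
  double cosine sum `Σ_{y,y′∈T} B(y)B(y′)cos(p·(y − y′))` (`normSq_FT`), `FTsq_nonneg`, `abs_FTsq_le`, continuity.
* §5 [folklore] the autocorrelation `corr T B z = Σ_{y−y′=z} B(y)B(y′)` (`corr_neg`, `corr_zero`, `corr_eq_tsum`),
  **`integral_cos_mul_FTsq`: `∫cos(p·z)|B̃(p)|²dp = (2π)^d C_B(z)`** and Plancherel `integral_FTsq`.
* §6 **`energy_eq_integral` — (1.66), Dirichlet side, scalar `ℤ^d`: `energy B = (2π)^{−d}∫ω(p)|B̃(p)|²dp`** for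
  `B` vanishing off `T` (`tsum_dir_sq_eq`: `Σ'_y (B(y) − B(y + e_μ))² = 2(C_B(0) − C_B(e_μ))`).
* §7 **`actionForm_eq_integral` — (1.66), scalar `ℤ^d`: `⟨B, Δ_kB⟩ = (2π)^{−d}∫σ_{n,a}(p)|B̃(p)|²dp`** for EVERY
  `T` and `B` (both sides read `B` on `T` only), through `integral_sigma_mul` (Tonelli for the `ℓ¹` series `σ`
  against a bounded continuous weight: Mathlib `integral_tsum_of_summable_integral_norm`, `κ ∈ ℓ¹` =
  `summable_abs_kappa`) and `tsum_kappa_mul_corr` (`Σ'_z κ(z)C_B(z) = actionForm`); and the inverse transform of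
  the symbol **`kappa_eq_integral`: `κ(z) = (2π)^{−d}∫σ(p)cos(p·z)dp`** (`kappa_even` from node 10's
  `actionKer_symm`) — the symbol determines the kernel.
* §8 **`form_bounds_of_symbol_bounds` — the printed inference (1.66) ⇒ (1.67)**: ANY bound `γ₀ω ≤ σ ≤ γ₁ω` on the
  zone gives `γ₀·energy B ≤ actionForm n a T B ≤ γ₁·energy B` (monotonicity of the momentum integral against
  `|B̃|² ≥ 0`); fed with node g8-2's `sigma_bounds` it returns exactly nodes 9 / g8-1's `ineq167_scalar` (an
  `example`: that statement is already a theorem of the tree).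

RELATION TO THE TREE (by name; nothing is imported from `Beta/` or from the torus line).  Node g8-2
(`B5Ineq167SymbolZd`, HONEST SCOPE (ii)) left «the Parseval / momentum-integral REPRESENTATION ⟨B, Δ_kB⟩ =
(2π)^{−d}∫σ(p)|B̂(p)|²dp of (1.66)» unformalised and obtained the multiplier bounds in the direction FORM ⇒
MULTIPLIER (trigonometric test pair + thermodynamic limit); this file supplies the representation and the paper's
direction MULTIPLIER ⇒ FORM, so that in the tree (1.66) now links `sigma_bounds` and `ineq167_scalar` both ways.
HONEST NOTE: this does not make the multiplier bounds independent of (1.67) — they still descend from nodes 9 /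
g8-1; what is new is the identity (1.66) itself (scalar, `ℤ^d`), the Dirichlet-side Parseval identity, the inverse
transform `κ = σ̌`, and the printed one-line inference as a theorem about arbitrary `γ₀, γ₁`.  `B4ContourShift` /
`B4Green244` supply the zone and `∫e^{ip·z}dp`; `B5Bounds167Lattice` (pv15) DEFINES a form by a printed multiplier on
a torus; `Beta.Ineq167Operator` / `Beta.Ineq167OperatorUpper` (an5) do finite Fourier analysis for the vector
operator on tori; the typed vector `H_k` (1.63)/(1.66) dictionary (b05) is a different object and is not touched.

HONEST SCOPE.  (i) SCALAR analogue: `|(∂₁B)~_μ(p)|² = |∂¹_μ(p)|²|B̃(p)|²`, `|∂¹_μ(p)|² = |e^{ip_μ} − 1|² =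
2 − 2cos p_μ` ((1.31) at `η = 1`) enters in the collapsed form `ω(p)|B̃(p)|²`; no field strength
`∂_μB_ν − ∂_νB_μ`, no gauge condition `R∂*A = 0`, no vector indices, and the explicit printed multiplier of (1.66)
is NOT the scalar `σ` (`σ` is the symbol of the scalar `Δ_k` of nodes 8 / 11 as an `ℓ¹` trigonometric series, not
in closed form); (ii) WHOLE lattice `ℤ^d` at `η = 1`: the dual-torus sum `(2π)^{−d}Σ_{p∈T̃′}(Π π/L′_μ)` of (1.29) is
replaced by its infinite-volume form `(2π)^{−d}∫_{[-π,π]^d}dp` (Lebesgue; the zone is taken closed — a null-set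
difference); (iii) the field is read on a finite window `T` (`energy_eq_integral`, `form_bounds_of_symbol_bounds`
need `B = 0` off `T`; `actionForm_eq_integral` holds for every `T`, `B`); (iv) nothing here is the torus statement,
the vector operator, the continuum limit or progress on any summit: value = kernel discharge of one printed identity
and one printed inference in the scalar infinite-volume setting.

ABSOLUTE-RULE CENSUS: every theorem below is proved outright from the tree modules named above and Mathlib
(sorry-free; axioms `propext`, `Classical.choice`, `Quot.sound` only); no quoted statement is used as a
hypothesis; the hypotheses of the headline theorems are `0 < a` (and `B = 0` off `T` on the Dirichlet side) only.
Unit `b2b-balaban-pv23-g9` (surge node prover #23, gen 9; journal claim B5-166-MOMENTUM-SCALAR-ZD); value =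
kernel discharge (scalar, infinite volume), NOT summit progress.
-/

namespace Literature.MathematicalPhysics.QuantumFieldTheory.Balaban1983to89.B5Momentum166Zd

open Finset Real Filter Topology MeasureTheory
open B6QGQLower276 B6QGQDecay237 B5Hk103ScalarZd B5Hk103Unique B5Hk103Minimizer B5Hk165ActionZd
  B5Ineq167LowerZd B5Ineq167UpperZd B5Hk165TranslZd B5Hk165PolarZd B5Ineq167SymbolZd
open B4ContourShift (BZ)

noncomputable section

variable {d : ℕ}

/-! ## §1  The Brillouin zone `[-π, π]^d` -/

/-- `[-π,π]^d` is the product of `d` copies of `[-π, π]`. [folklore] -/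
theorem BZ_eq_pi : BZ d = Set.pi Set.univ (fun _ : Fin d => Set.Icc (-π) π) := (Set.pi_univ_Icc _ _).symm

/-- `[-π,π]^d` is compact. [folklore] -/
theorem isCompact_BZ : IsCompact (BZ d) := by unfold BZ; exact isCompact_Icc

/-- `[-π,π]^d` is measurable. [folklore] -/
theorem measurableSet_BZ : MeasurableSet (BZ d) := by unfold BZ; exact measurableSet_Icc

/-- `[-π,π]^d` has finite Lebesgue measure. [folklore] -/
theorem volume_BZ_lt_top : volume (BZ d) < ⊤ := isCompact_BZ.measure_lt_top

/-- `|[-π,π]^d| = (2π)^d`. [folklore] -/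
theorem volume_real_BZ : volume.real (BZ d) = (2 * π) ^ d := by
  unfold BZ
  rw [Measure.real, Real.volume_Icc_pi_toReal (fun _ => by linarith [Real.pi_pos])]
  simp only [sub_neg_eq_add, Finset.prod_const, Finset.card_univ, Fintype.card_fin]
  ring

/-- A continuous function is integrable on `[-π,π]^d`. [folklore] -/
theorem integrableOn_BZ {f : (Fin d → ℝ) → ℝ} (hf : Continuous f) : IntegrableOn f (BZ d) := by
  unfold BZ; exact hf.integrableOn_Icc

/-- A continuous complex function is integrable on `[-π,π]^d`. [folklore] -/
theorem integrableOn_BZ' {f : (Fin d → ℝ) → ℂ} (hf : Continuous f) : IntegrableOn f (BZ d) := by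
  unfold BZ; exact hf.integrableOn_Icc

/-! ## §2  The phase `p·z` (real, node g8-2) versus the complex phase of `B4ContourShift` -/

/-- The complex phase of `B4ContourShift` is the real phase of node g8-2, cast. [folklore] -/
theorem phaseC_eq (p : Fin d → ℝ) (z : X d) : B4ContourShift.phase p z = ((phase p z : ℝ) : ℂ) := by
  unfold B4ContourShift.phase phase
  push_cast
  rfl

/-- `p ↦ p·z` is continuous. [folklore] -/
theorem continuous_phase (z : X d) : Continuous fun p : Fin d → ℝ => phase p z := by
  unfold phase
  exact continuous_finsetSum _ fun μ _ => (continuous_apply μ).mul continuous_const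

/-- `p ↦ cos(p·z)` is continuous. [folklore] -/
theorem continuous_cos_phase (z : X d) : Continuous fun p : Fin d → ℝ => Real.cos (phase p z) :=
  Real.continuous_cos.comp (continuous_phase z)

/-- `Re e^{i p·z} = cos(p·z)`. [folklore] -/
theorem re_cexp_phase (p : Fin d → ℝ) (z : X d) :
    RCLike.re (Complex.exp (Complex.I * B4ContourShift.phase p z)) = Real.cos (phase p z) := by
  rw [phaseC_eq, mul_comm, RCLike.re_to_complex, Complex.exp_ofReal_mul_I_re]

/-! ## §3  Orthogonality of the characters on the zone -/

/-- **`∫_{[-π,π]^d} cos(p·z) dp = (2π)^d δ_{z,0}`** (`z ∈ ℤ^d`) — the real part of `B4Green244.fourierBox_one`. [folklore] -/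
theorem integral_cos_phase (z : X d) :
    ∫ p in BZ d, Real.cos (phase p z) = if z = 0 then (2 * π) ^ d else 0 := by
  have h1 := B4Green244.fourierBox_one z
  unfold B4ContourShift.fourierBox B4ContourShift.integrand at h1
  simp only [one_mul] at h1
  have hint : Integrable (fun p : Fin d → ℝ => Complex.exp (Complex.I * B4ContourShift.phase p z))
      (volume.restrict (BZ d)) := by
    refine integrableOn_BZ' ?_
    unfold B4ContourShift.phase
    fun_prop
  have h2 := integral_re hint
  rw [h1] at h2
  simp_rw [re_cexp_phase] at h2
  rw [h2]
  split_ifs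
  · rw [show ((2 : ℂ) * ↑π) ^ d = (((2 * π) ^ d : ℝ) : ℂ) by push_cast; ring, RCLike.re_to_complex,
      Complex.ofReal_re]
  · simp

/-- `cos(p·z)cos(p·w) = ½(cos(p·(z + w)) + cos(p·(z − w)))`. [folklore] -/
theorem cos_phase_mul_cos_phase (p : Fin d → ℝ) (z w : X d) :
    Real.cos (phase p z) * Real.cos (phase p w)
      = (Real.cos (phase p (z + w)) + Real.cos (phase p (z - w))) / 2 := by
  rw [phase_add, phase_sub, Real.cos_add, Real.cos_sub]
  ring

/-- **`∫_{[-π,π]^d} cos(p·z)cos(p·w) dp = ½(2π)^d (δ_{z+w,0} + δ_{z,w})`**. [folklore] -/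
theorem integral_cos_mul_cos (z w : X d) :
    ∫ p in BZ d, Real.cos (phase p z) * Real.cos (phase p w)
      = ((if z + w = 0 then (2 * π) ^ d else 0) + (if z - w = 0 then (2 * π) ^ d else 0)) / 2 := by
  simp_rw [cos_phase_mul_cos_phase]
  rw [integral_div, integral_add (integrableOn_BZ (continuous_cos_phase _))
    (integrableOn_BZ (continuous_cos_phase _)), integral_cos_phase, integral_cos_phase]

/-! ## §4  The lattice Fourier transform (1.29) at `η = 1` of a coarse field on a support window `T` -/

/-- **(1.29) at `η = 1`**: `B̃(p) = Σ_{y ∈ T} e^{−ip·y} B(y)` for a field read on the finite window `T ⊂ ℤ^d`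
(for `B` vanishing off `T` this is the whole-lattice transform). [cite: Balaban1984PropagatorsI, (1.29) p.23] -/
def FT (T : Finset (X d)) (Bf : X d → ℝ) (p : Fin d → ℝ) : ℂ :=
  ∑ y ∈ T, (Bf y : ℂ) * Complex.exp (((-phase p y : ℝ) : ℂ) * Complex.I)

/-- **`|B̃(p)|²` in manifestly real form**: `Σ_{y,y′ ∈ T} B(y)B(y′)cos(p·(y − y′))`. [folklore] -/
def FTsq (T : Finset (X d)) (Bf : X d → ℝ) (p : Fin d → ℝ) : ℝ :=
  ∑ y ∈ T, ∑ y' ∈ T, Bf y * Bf y' * Real.cos (phase p (y - y'))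

/-- `Re B̃(p) = Σ_y B(y)cos(p·y)`. [folklore] -/
theorem FT_re (T : Finset (X d)) (Bf : X d → ℝ) (p : Fin d → ℝ) :
    (FT T Bf p).re = ∑ y ∈ T, Bf y * Real.cos (phase p y) := by
  unfold FT
  rw [Complex.re_sum]
  refine Finset.sum_congr rfl fun y _ => ?_
  rw [Complex.re_ofReal_mul, Complex.exp_ofReal_mul_I_re, Real.cos_neg]

/-- `Im B̃(p) = −Σ_y B(y)sin(p·y)`. [folklore] -/
theorem FT_im (T : Finset (X d)) (Bf : X d → ℝ) (p : Fin d → ℝ) :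
    (FT T Bf p).im = -∑ y ∈ T, Bf y * Real.sin (phase p y) := by
  unfold FT
  rw [Complex.im_sum, ← Finset.sum_neg_distrib]
  refine Finset.sum_congr rfl fun y _ => ?_
  rw [Complex.im_ofReal_mul, Complex.exp_ofReal_mul_I_im, Real.sin_neg, mul_neg]

/-- **`|B̃(p)|² = FTsq`**: the modulus squared of (1.29) is the real double cosine sum. [folklore] -/
theorem normSq_FT (T : Finset (X d)) (Bf : X d → ℝ) (p : Fin d → ℝ) :
    Complex.normSq (FT T Bf p) = FTsq T Bf p := by
  rw [Complex.normSq_apply, FT_re, FT_im]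
  unfold FTsq
  rw [neg_mul_neg, Finset.sum_mul_sum, Finset.sum_mul_sum, ← Finset.sum_add_distrib]
  refine Finset.sum_congr rfl fun y _ => ?_
  rw [← Finset.sum_add_distrib]
  refine Finset.sum_congr rfl fun y' _ => ?_
  rw [phase_sub, Real.cos_sub]
  ring

/-- `|B̃(p)|² ≥ 0`. [folklore] -/
theorem FTsq_nonneg (T : Finset (X d)) (Bf : X d → ℝ) (p : Fin d → ℝ) : 0 ≤ FTsq T Bf p := by
  rw [← normSq_FT]; exact Complex.normSq_nonneg _

/-- `|B̃(p)|² ≤ (Σ_y |B(y)|)²`. [folklore] -/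
theorem abs_FTsq_le (T : Finset (X d)) (Bf : X d → ℝ) (p : Fin d → ℝ) :
    |FTsq T Bf p| ≤ ∑ y ∈ T, ∑ y' ∈ T, |Bf y| * |Bf y'| := by
  unfold FTsq
  refine (Finset.abs_sum_le_sum_abs _ _).trans (Finset.sum_le_sum fun y _ => ?_)
  refine (Finset.abs_sum_le_sum_abs _ _).trans (Finset.sum_le_sum fun y' _ => ?_)
  rw [abs_mul, abs_mul]
  exact mul_le_of_le_one_right (by positivity) (Real.abs_cos_le_one _)

/-- `p ↦ |B̃(p)|²` is continuous. [folklore] -/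
theorem continuous_FTsq (T : Finset (X d)) (Bf : X d → ℝ) : Continuous fun p : Fin d → ℝ => FTsq T Bf p := by
  unfold FTsq
  exact continuous_finsetSum _ fun y _ => continuous_finsetSum _ fun y' _ =>
    continuous_const.mul (continuous_cos_phase _)

/-- `p ↦ ω(p)` is continuous. [folklore] -/
theorem continuous_omega : Continuous (omega (d := d)) := by
  unfold omega
  exact continuous_finsetSum _ fun μ _ => continuous_const.sub (continuous_const.mul
    (Real.continuous_cos.comp (continuous_apply μ)))

/-! ## §5  The autocorrelation of the field and the basic momentum integral -/

/-- The AUTOCORRELATION `C_B(z) = Σ_{y,y′ ∈ T, y − y′ = z} B(y)B(y′)`. [folklore] -/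
def corr (T : Finset (X d)) (Bf : X d → ℝ) (z : X d) : ℝ :=
  ∑ y ∈ T, ∑ y' ∈ T, if y - y' = z then Bf y * Bf y' else 0

/-- `C_B` is even. [folklore] -/
theorem corr_neg (T : Finset (X d)) (Bf : X d → ℝ) (z : X d) : corr T Bf (-z) = corr T Bf z := by
  unfold corr
  rw [Finset.sum_comm]
  refine Finset.sum_congr rfl fun y _ => Finset.sum_congr rfl fun y' _ => ?_
  have h : (y' - y = -z) ↔ (y - y' = z) := by rw [← neg_sub, neg_inj]
  by_cases hc : y - y' = z
  · rw [if_pos (h.mpr hc), if_pos hc, mul_comm]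
  · rw [if_neg (fun h' => hc (h.mp h')), if_neg hc]

/-- `C_B(0) = Σ_y B(y)²`. [folklore] -/
theorem corr_zero (T : Finset (X d)) (Bf : X d → ℝ) : corr T Bf 0 = ∑ y ∈ T, Bf y ^ 2 := by
  unfold corr
  refine Finset.sum_congr rfl fun y hy => ?_
  simp_rw [sub_eq_zero]
  rw [Finset.sum_ite_eq T y, if_pos hy, sq]

/-- `C_B(z) = Σ'_{y′} B(y′ + z)B(y′)` for `B` vanishing off `T`. [folklore] -/
theorem corr_eq_tsum {T : Finset (X d)} {Bf : X d → ℝ} (hT : ∀ y ∉ T, Bf y = 0) (z : X d) :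
    corr T Bf z = ∑' y', Bf (y' + z) * Bf y' := by
  unfold corr
  rw [Finset.sum_comm]
  have hs : ∀ y' ∉ T, Bf (y' + z) * Bf y' = 0 := fun y' hy' => by rw [hT y' hy', mul_zero]
  rw [tsum_eq_sum (s := T) (fun y' hy' => hs y' hy')]
  refine Finset.sum_congr rfl fun y' _ => ?_
  have hiff : ∀ y, (y - y' = z) ↔ (y = y' + z) := fun y => by rw [sub_eq_iff_eq_add, add_comm]
  simp_rw [hiff]
  rw [Finset.sum_ite_eq' T (y' + z)]
  by_cases hm : y' + z ∈ T
  · rw [if_pos hm]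
  · rw [if_neg hm, hT _ hm, zero_mul]

/-- The integrand `cos(p·z)·|B̃(p)|²` expanded. [folklore] -/
theorem cos_mul_FTsq (T : Finset (X d)) (Bf : X d → ℝ) (p : Fin d → ℝ) (z : X d) :
    Real.cos (phase p z) * FTsq T Bf p
      = ∑ y ∈ T, ∑ y' ∈ T, Bf y * Bf y' * (Real.cos (phase p z) * Real.cos (phase p (y - y'))) := by
  unfold FTsq
  rw [Finset.mul_sum]
  refine Finset.sum_congr rfl fun y _ => ?_
  rw [Finset.mul_sum]
  refine Finset.sum_congr rfl fun y' _ => ?_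
  ring

/-- **The basic momentum integral**: `∫_{[-π,π]^d} cos(p·z)|B̃(p)|² dp = (2π)^d·C_B(z)` (`z ∈ ℤ^d`). [folklore] -/
theorem integral_cos_mul_FTsq (T : Finset (X d)) (Bf : X d → ℝ) (z : X d) :
    ∫ p in BZ d, Real.cos (phase p z) * FTsq T Bf p = (2 * π) ^ d * corr T Bf z := by
  have hcorr : (2 * π) ^ d * corr T Bf z = ((2 * π) ^ d * corr T Bf (-z) + (2 * π) ^ d * corr T Bf z) / 2 := by
    rw [corr_neg]; ring
  rw [hcorr]
  simp_rw [cos_mul_FTsq]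
  rw [integral_finsetSum _ fun y _ => ?_]
  swap
  · exact integrableOn_BZ (continuous_finsetSum _ fun y' _ =>
      continuous_const.mul ((continuous_cos_phase _).mul (continuous_cos_phase _)))
  have hin : ∀ y ∈ T, ∫ p in BZ d, ∑ y' ∈ T, Bf y * Bf y' * (Real.cos (phase p z) * Real.cos (phase p (y - y')))
      = ∑ y' ∈ T, Bf y * Bf y' * (((if z + (y - y') = 0 then (2 * π) ^ d else 0)
          + (if z - (y - y') = 0 then (2 * π) ^ d else 0)) / 2) := fun y _ => by
    rw [integral_finsetSum _ fun y' _ => ?_]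
    swap
    · exact integrableOn_BZ (continuous_const.mul ((continuous_cos_phase _).mul (continuous_cos_phase _)))
    refine Finset.sum_congr rfl fun y' _ => ?_
    rw [integral_const_mul, integral_cos_mul_cos]
  rw [Finset.sum_congr rfl hin]
  unfold corr
  rw [Finset.mul_sum, Finset.mul_sum, ← Finset.sum_add_distrib, Finset.sum_div]
  refine Finset.sum_congr rfl fun y _ => ?_
  rw [Finset.mul_sum, Finset.mul_sum, ← Finset.sum_add_distrib, Finset.sum_div]
  refine Finset.sum_congr rfl fun y' _ => ?_
  have h1 : (z + (y - y') = 0) ↔ (y - y' = -z) := by rw [add_comm, add_eq_zero_iff_eq_neg]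
  have h2 : (z - (y - y') = 0) ↔ (y - y' = z) := by rw [sub_eq_zero, eq_comm]
  simp only [h1, h2]
  split_ifs <;> ring

/-- **Plancherel for (1.29) at `η = 1`**: `∫_{[-π,π]^d} |B̃(p)|² dp = (2π)^d Σ_y B(y)²`. [folklore] -/
theorem integral_FTsq (T : Finset (X d)) (Bf : X d → ℝ) :
    ∫ p in BZ d, FTsq T Bf p = (2 * π) ^ d * ∑ y ∈ T, Bf y ^ 2 := by
  have h := integral_cos_mul_FTsq T Bf 0
  simp_rw [phase_zero, Real.cos_zero, one_mul] at h
  rw [h, corr_zero]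

/-! ## §6  `⟨∂₁B, ∂₁B⟩` in momentum representation: `energy B = (2π)^{−d}∫ ω(p)|B̃(p)|² dp` -/

/-- One direction of the Dirichlet energy as an autocorrelation: `Σ'_y (B(y) − B(y + e_μ))² = 2(C_B(0) − C_B(e_μ))`.
[folklore] -/
theorem tsum_dir_sq_eq {T : Finset (X d)} {Bf : X d → ℝ} (hT : ∀ y ∉ T, Bf y = 0) (μ : Fin d) :
    ∑' y, (Bf y - Bf (y + e μ)) ^ 2 = 2 * (∑ y ∈ T, Bf y ^ 2 - corr T Bf (e μ)) := by
  have h1 : Summable fun y => Bf y ^ 2 := summable_sq_of_support hT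
  have h2 : Summable fun y => Bf (y + e μ) ^ 2 := by
    simpa [Function.comp_def] using h1.comp_injective (add_left_injective (e μ))
  have h3 : Summable fun y => Bf (y + e μ) * Bf y :=
    summable_of_ne_finset_zero (s := T) fun y hy => by rw [hT y hy, mul_zero]
  have hexp : ∀ y, (Bf y - Bf (y + e μ)) ^ 2 = (Bf y ^ 2 + Bf (y + e μ) ^ 2) - 2 * (Bf (y + e μ) * Bf y) :=
    fun y => by ring
  simp_rw [hexp]
  rw [(h1.add h2).tsum_sub (h3.mul_left 2), h1.tsum_add h2, tsum_mul_left,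
    tsum_shift (fun y => Bf y ^ 2) (e μ), tsum_eq_sum (s := T) (fun y hy => by rw [hT y hy]; ring),
    ← corr_eq_tsum hT]
  ring

/-- The Dirichlet-symbol integral, one direction: `∫ (2 − 2cos p_μ)|B̃(p)|² dp = (2π)^d·2(C_B(0) − C_B(e_μ))`.
[folklore] -/
theorem integral_dir_mul_FTsq (T : Finset (X d)) (Bf : X d → ℝ) (μ : Fin d) :
    ∫ p in BZ d, (2 - 2 * Real.cos (p μ)) * FTsq T Bf p
      = (2 * π) ^ d * (2 * (∑ y ∈ T, Bf y ^ 2 - corr T Bf (e μ))) := by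
  have hre : ∀ p : Fin d → ℝ, (2 - 2 * Real.cos (p μ)) * FTsq T Bf p
      = 2 * FTsq T Bf p - 2 * (Real.cos (phase p (e μ)) * FTsq T Bf p) := fun p => by
    rw [phase_e]; ring
  simp_rw [hre]
  have i1 : IntegrableOn (fun p : Fin d → ℝ => 2 * FTsq T Bf p) (BZ d) :=
    integrableOn_BZ (continuous_const.mul (continuous_FTsq T Bf))
  have i2 : IntegrableOn (fun p : Fin d → ℝ => 2 * (Real.cos (phase p (e μ)) * FTsq T Bf p)) (BZ d) :=
    integrableOn_BZ (continuous_const.mul ((continuous_cos_phase _).mul (continuous_FTsq T Bf)))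
  rw [integral_sub i1 i2, integral_const_mul, integral_const_mul, integral_FTsq, integral_cos_mul_FTsq]
  ring

/-- **(1.66), Dirichlet side, scalar `ℤ^d`: `⟨∂₁B, ∂₁B⟩ = (2π)^{−d} ∫_{[-π,π]^d} ω(p)|B̃(p)|² dp`** —
`|(∂₁B)~_μ(p)|² = |∂¹_μ(p)|²|B̃(p)|²`, `|∂¹_μ(p)|² = |e^{ip_μ} − 1|² = 2 − 2cos p_μ` ((1.31) at `η = 1`).
[cite: Balaban1984PropagatorsI, (1.66) p.29] -/
theorem energy_eq_integral {T : Finset (X d)} (Bf : X d → ℝ) (hT : ∀ y ∉ T, Bf y = 0) :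
    energy Bf = ((2 * π) ^ d)⁻¹ * ∫ p in BZ d, omega p * FTsq T Bf p := by
  have hc : (0 : ℝ) < (2 * π) ^ d := by positivity
  unfold energy
  rw [Finset.sum_congr rfl fun μ _ => tsum_dir_sq_eq hT μ]
  unfold omega
  simp_rw [Finset.sum_mul]
  rw [integral_finsetSum _ fun μ _ => ?_]
  swap
  · exact integrableOn_BZ ((continuous_const.sub (continuous_const.mul
      (Real.continuous_cos.comp (continuous_apply μ)))).mul (continuous_FTsq T Bf))
  rw [Finset.sum_congr rfl fun μ _ => integral_dir_mul_FTsq T Bf μ, Finset.mul_sum]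
  refine Finset.sum_congr rfl fun μ _ => ?_
  rw [← mul_assoc, inv_mul_cancel₀ hc.ne', one_mul]

/-! ## §7  (1.66), scalar `ℤ^d`: `⟨B, Δ_kB⟩ = (2π)^{−d} ∫_{[-π,π]^d} σ(p)|B̃(p)|² dp` -/

/-- The kernel side: `Σ'_z κ(z)C_B(z) = ⟨B, Δ_kB⟩`. [folklore] -/
theorem tsum_kappa_mul_corr (n : ℕ) {a : ℝ} (ha : 0 < a) (T : Finset (X d)) (Bf : X d → ℝ) :
    ∑' z, kappa n a z * corr T Bf z = actionForm n a T Bf := by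
  rw [actionForm_eq_kappa n ha]
  unfold corr
  simp_rw [Finset.mul_sum]
  have hterm : ∀ (y y' z : X d), z ≠ y - y' →
      kappa n a z * (if y - y' = z then Bf y * Bf y' else 0) = 0 := fun y y' z hz => by
    rw [if_neg (fun h => hz h.symm), mul_zero]
  have hsum1 : ∀ y y' : X d, Summable fun z => kappa n a z * (if y - y' = z then Bf y * Bf y' else 0) :=
    fun y y' => summable_of_ne_finset_zero (s := {y - y'}) fun z hz => hterm y y' z (by simpa using hz)
  rw [Summable.tsum_finsetSum fun y _ => summable_sum fun y' _ => hsum1 y y']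
  refine Finset.sum_congr rfl fun y _ => ?_
  rw [Summable.tsum_finsetSum fun y' _ => hsum1 y y']
  refine Finset.sum_congr rfl fun y' _ => ?_
  rw [tsum_eq_single (y - y') (hterm y y'), if_pos rfl]
  ring

/-- The `z`-th term of `σ(p)G(p)` for a weight `G`: `κ(z)cos(p·z)G(p)`. [folklore] -/
def termZ (n : ℕ) (a : ℝ) (G : (Fin d → ℝ) → ℝ) (z : X d) (p : Fin d → ℝ) : ℝ :=
  kappa n a z * (Real.cos (phase p z) * G p)

/-- `σ(p)G(p) = Σ'_z κ(z)cos(p·z)G(p)`. [folklore] -/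
theorem sigma_mul_eq_tsum (n : ℕ) (a : ℝ) (G : (Fin d → ℝ) → ℝ) (p : Fin d → ℝ) :
    sigma n a p * G p = ∑' z, termZ n a G z p := by
  unfold sigma termZ
  rw [← tsum_mul_right]
  exact tsum_congr fun z => mul_assoc _ _ _

/-- Each term is integrable on the zone (continuous weight). [folklore] -/
theorem integrable_termZ (n : ℕ) (a : ℝ) {G : (Fin d → ℝ) → ℝ} (hG : Continuous G) (z : X d) :
    Integrable (termZ n a G z) (volume.restrict (BZ d)) := by
  refine integrableOn_BZ ?_
  unfold termZ
  exact continuous_const.mul ((continuous_cos_phase z).mul hG)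

/-- The `L¹(dp)`-norms of the terms are summable over `z` (`κ ∈ ℓ¹`, `|cos| ≤ 1`, `|G| ≤ M` on the zone).
[folklore] -/
theorem summable_integral_norm_termZ (n : ℕ) {a : ℝ} (ha : 0 < a) {G : (Fin d → ℝ) → ℝ} (hG : Continuous G)
    {M : ℝ} (hM : ∀ p ∈ BZ d, |G p| ≤ M) :
    Summable fun z : X d => ∫ p in BZ d, ‖termZ n a G z p‖ := by
  refine Summable.of_nonneg_of_le (fun z => integral_nonneg fun p => norm_nonneg _)
    (fun z => ?_) ((summable_abs_kappa n ha).mul_right (M * (2 * π) ^ d))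
  have hpt : ∀ p ∈ BZ d, ‖termZ n a G z p‖ ≤ |kappa n a z| * M := fun p hp => by
    unfold termZ
    rw [Real.norm_eq_abs, abs_mul, abs_mul]
    refine mul_le_mul_of_nonneg_left ?_ (abs_nonneg _)
    calc |Real.cos (phase p z)| * |G p| ≤ 1 * M :=
          mul_le_mul (Real.abs_cos_le_one _) (hM p hp) (abs_nonneg _) zero_le_one
      _ = M := one_mul M
  have hmono : ∫ p in BZ d, ‖termZ n a G z p‖ ≤ ∫ p in BZ d, |kappa n a z| * M :=
    setIntegral_mono_on (integrable_termZ n a hG z).norm (integrableOn_BZ continuous_const)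
      measurableSet_BZ hpt
  rw [setIntegral_const, volume_real_BZ, smul_eq_mul] at hmono
  calc ∫ p in BZ d, ‖termZ n a G z p‖ ≤ (2 * π) ^ d * (|kappa n a z| * M) := hmono
    _ = |kappa n a z| * (M * (2 * π) ^ d) := by ring

/-- **Tonelli for the symbol series**: `∫σ(p)G(p)dp = Σ'_z κ(z)∫cos(p·z)G(p)dp` for a bounded continuous weight `G`
on the zone. [folklore] -/
theorem integral_sigma_mul (n : ℕ) {a : ℝ} (ha : 0 < a) {G : (Fin d → ℝ) → ℝ} (hG : Continuous G)
    {M : ℝ} (hM : ∀ p ∈ BZ d, |G p| ≤ M) :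
    ∫ p in BZ d, sigma n a p * G p = ∑' z, kappa n a z * ∫ p in BZ d, Real.cos (phase p z) * G p := by
  simp_rw [sigma_mul_eq_tsum]
  rw [← integral_tsum_of_summable_integral_norm (integrable_termZ n a hG)
    (summable_integral_norm_termZ n ha hG hM)]
  unfold termZ
  simp_rw [integral_const_mul]

/-- `κ` is even (node 10: the scalar `Δ_k` is symmetric). [folklore] -/
theorem kappa_even (n : ℕ) {a : ℝ} (ha : 0 < a) (z : X d) : kappa n a (-z) = kappa n a z := by
  unfold kappa
  rw [actionKer_symm n ha (-z) 0, actionKer_eq_kappa n ha 0 (-z), actionKer_eq_kappa n ha z 0, sub_neg_eq_add,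
    zero_add, sub_zero]

/-- **The symbol determines the kernel — the inverse transform (1.29) of `σ`**:
`∫_{[-π,π]^d} σ(p)cos(p·z)dp = (2π)^d κ(z)`. [folklore] -/
theorem integral_sigma_mul_cos (n : ℕ) {a : ℝ} (ha : 0 < a) (z : X d) :
    ∫ p in BZ d, sigma n a p * Real.cos (phase p z) = (2 * π) ^ d * kappa n a z := by
  rw [integral_sigma_mul n ha (continuous_cos_phase z) (M := 1) (fun p _ => Real.abs_cos_le_one _)]
  simp_rw [integral_cos_mul_cos]
  have hpt : ∀ w : X d, kappa n a w * (((if w + z = 0 then (2 * π) ^ d else 0)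
      + (if w - z = 0 then (2 * π) ^ d else 0)) / 2)
        = (if w = -z then (2 * π) ^ d / 2 * kappa n a w else 0)
          + (if w = z then (2 * π) ^ d / 2 * kappa n a w else 0) := fun w => by
    simp only [add_eq_zero_iff_eq_neg, sub_eq_zero]
    split_ifs <;> ring
  simp_rw [hpt]
  have s1 : Summable fun w : X d => if w = -z then (2 * π) ^ d / 2 * kappa n a w else 0 :=
    summable_of_ne_finset_zero (s := {-z}) fun w hw => if_neg (by simpa using hw)
  have s2 : Summable fun w : X d => if w = z then (2 * π) ^ d / 2 * kappa n a w else 0 :=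
    summable_of_ne_finset_zero (s := {z}) fun w hw => if_neg (by simpa using hw)
  rw [s1.tsum_add s2, tsum_eq_single (-z) (fun w hw => if_neg hw), tsum_eq_single z (fun w hw => if_neg hw),
    if_pos rfl, if_pos rfl, kappa_even n ha z]
  ring

/-- `κ(z) = (2π)^{−d}∫σ(p)cos(p·z)dp`. [folklore] -/
theorem kappa_eq_integral (n : ℕ) {a : ℝ} (ha : 0 < a) (z : X d) :
    kappa n a z = ((2 * π) ^ d)⁻¹ * ∫ p in BZ d, sigma n a p * Real.cos (phase p z) := by
  have hc : (0 : ℝ) < (2 * π) ^ d := by positivity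
  rw [integral_sigma_mul_cos n ha z, ← mul_assoc, inv_mul_cancel₀ hc.ne', one_mul]

/-- **(1.66), scalar, whole lattice `ℤ^d` — THE MOMENTUM REPRESENTATION OF THE COARSE ACTION:
`⟨B, Δ_kB⟩ = (2π)^{−d} ∫_{[-π,π]^d} σ_{n,a}(p)|B̃(p)|² dp`**, where `σ_{n,a}(p) = Σ'_z κ(z)cos(p·z)` is the symbol of
the scalar `Δ_k` (node g8-2) and `B̃` is (1.29) at `η = 1`; every block side `n + 1`, every `a > 0`, every finite
window `T` and every `B`. [cite: Balaban1984PropagatorsI, (1.66) p.29] -/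
theorem actionForm_eq_integral (n : ℕ) {a : ℝ} (ha : 0 < a) (T : Finset (X d)) (Bf : X d → ℝ) :
    actionForm n a T Bf = ((2 * π) ^ d)⁻¹ * ∫ p in BZ d, sigma n a p * FTsq T Bf p := by
  have hc : (0 : ℝ) < (2 * π) ^ d := by positivity
  rw [integral_sigma_mul n ha (continuous_FTsq T Bf) (fun p _ => abs_FTsq_le T Bf p)]
  simp_rw [integral_cos_mul_FTsq]
  have h : ∑' z : X d, kappa n a z * ((2 * π) ^ d * corr T Bf z) = (2 * π) ^ d * actionForm n a T Bf := by
    rw [← tsum_kappa_mul_corr n ha T Bf, ← tsum_mul_left]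
    exact tsum_congr fun z => by ring
  rw [h, ← mul_assoc, inv_mul_cancel₀ hc.ne', one_mul]

/-- The same with `|B̃(p)|²` written as `Complex.normSq` of (1.29). [cite: Balaban1984PropagatorsI, (1.66) p.29] -/
theorem actionForm_eq_integral_normSq (n : ℕ) {a : ℝ} (ha : 0 < a) (T : Finset (X d)) (Bf : X d → ℝ) :
    actionForm n a T Bf = ((2 * π) ^ d)⁻¹ * ∫ p in BZ d, sigma n a p * Complex.normSq (FT T Bf p) := by
  simp_rw [normSq_FT]; exact actionForm_eq_integral n ha T Bf

/-! ## §8  The printed inference MULTIPLIER ⇒ FORM: bounds on the function under the integral give (1.67) -/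

/-- Monotonicity of the momentum integral in the multiplier against the non-negative weight `|B̃|²`. [folklore] -/
theorem integral_mul_FTsq_mono {f g : (Fin d → ℝ) → ℝ} (hf : Continuous f) (hg : Continuous g)
    (hfg : ∀ p ∈ BZ d, f p ≤ g p) (T : Finset (X d)) (Bf : X d → ℝ) :
    ∫ p in BZ d, f p * FTsq T Bf p ≤ ∫ p in BZ d, g p * FTsq T Bf p :=
  setIntegral_mono_on (integrableOn_BZ (hf.mul (continuous_FTsq T Bf)))
    (integrableOn_BZ (hg.mul (continuous_FTsq T Bf))) measurableSet_BZ
    fun p hp => mul_le_mul_of_nonneg_right (hfg p hp) (FTsq_nonneg T Bf p)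

/-- **Bałaban's inference (1.66) ⇒ (1.67), scalar `ℤ^d`: «The function under the integral is bounded from below and
above by positive constants γ₀, γ₁ […], so we have γ₀⟨∂₁B, ∂₁B⟩ ≦ ⟨B, Δ_kB⟩ ≦ γ₁⟨∂₁B, ∂₁B⟩»** — ANY two-sided
bound `γ₀ω ≤ σ ≤ γ₁ω` on the zone gives the form inequality with the same constants, by the two momentum
representations and `|B̃|² ≥ 0`. [cite: Balaban1984PropagatorsI, (1.66)–(1.67) p.29] -/
theorem form_bounds_of_symbol_bounds (n : ℕ) {a : ℝ} (ha : 0 < a) {γ₀ γ₁ : ℝ}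
    (hσ : ∀ p ∈ BZ d, γ₀ * omega p ≤ sigma n a p ∧ sigma n a p ≤ γ₁ * omega p)
    {T : Finset (X d)} (Bf : X d → ℝ) (hT : ∀ y ∉ T, Bf y = 0) :
    γ₀ * energy Bf ≤ actionForm n a T Bf ∧ actionForm n a T Bf ≤ γ₁ * energy Bf := by
  have hc : (0 : ℝ) < ((2 * π) ^ d)⁻¹ := by positivity
  rw [actionForm_eq_integral n ha T Bf, energy_eq_integral Bf hT]
  have hlo := integral_mul_FTsq_mono (f := fun p => γ₀ * omega p) (g := sigma n a)
    (continuous_const.mul continuous_omega) (continuous_sigma n ha) (fun p hp => (hσ p hp).1) T Bf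
  have hhi := integral_mul_FTsq_mono (f := sigma n a) (g := fun p => γ₁ * omega p)
    (continuous_sigma n ha) (continuous_const.mul continuous_omega) (fun p hp => (hσ p hp).2) T Bf
  simp_rw [mul_assoc, integral_const_mul] at hlo hhi
  constructor
  · calc γ₀ * (((2 * π) ^ d)⁻¹ * ∫ p in BZ d, omega p * FTsq T Bf p)
        = ((2 * π) ^ d)⁻¹ * (γ₀ * ∫ p in BZ d, omega p * FTsq T Bf p) := by ring
      _ ≤ ((2 * π) ^ d)⁻¹ * ∫ p in BZ d, sigma n a p * FTsq T Bf p := mul_le_mul_of_nonneg_left hlo hc.le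
  · calc ((2 * π) ^ d)⁻¹ * ∫ p in BZ d, sigma n a p * FTsq T Bf p
        ≤ ((2 * π) ^ d)⁻¹ * (γ₁ * ∫ p in BZ d, omega p * FTsq T Bf p) := mul_le_mul_of_nonneg_left hhi hc.le
      _ = γ₁ * (((2 * π) ^ d)⁻¹ * ∫ p in BZ d, omega p * FTsq T Bf p) := by ring

/-- The loop closes: node g8-2's multiplier bounds `ω ≤ σ ≤ γ₁(d)ω` (`sigma_bounds`, themselves derived from the
form inequality) return, through (1.66), exactly the kernel-proved (1.67) of nodes 9 / g8-1 (`ineq167_scalar`) —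
stated as an `example` only (the statement is already a theorem of the tree). -/
example (n : ℕ) {a : ℝ} (ha : 0 < a) {T : Finset (X d)} (Bf : X d → ℝ) (hT : ∀ y ∉ T, Bf y = 0) :
    energy Bf ≤ actionForm n a T Bf ∧ actionForm n a T Bf ≤ gamma1 d * energy Bf := by
  have h := form_bounds_of_symbol_bounds n ha (γ₀ := 1) (γ₁ := gamma1 d)
    (fun p _ => by rw [one_mul]; exact sigma_bounds n ha p) Bf hT
  rwa [one_mul] at h

end

end Literature.MathematicalPhysics.QuantumFieldTheory.Balaban1983to89.B5Momentum166Zd
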